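import Summits.ResolutionOfSingularities.ResolutionOfSingularities.Theorems.PurelyInseparableDim4AtlasMemberDefsTwo
import HarnessLib

/-!
# Purely inseparable four-folds: a CHART-INDEXED atlas gives `MemberAtlasZF` (brick S3 (c) v4, tranche 1, bridge; cell `res-dim4-pi`)

[OURS · counted 0] (D-0157 DOOR 2; host item stmt-ResolutionOfSingularities-16155, helper). Nothing here proves resolution of
singularities in dimension ≥ 4 / characteristic `p`. Bookkeeping only: the v4 definitions (`MemberAtlasZF`, p713131) index the zigzag
charts of an atlas member by its finite set of READINGS `R : Finset (AReading K)`, while the child package A1 produces them indexed by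
CHARTS `m ∈ Pc ⊆ Fin 4` with an injective reading map `rd : Fin 4 → AReading K` (`res-dim4-typ-3/S3c-V4-ATLAS-MEMBERS-DESIGN.md` §9 (I5)).
This file converts: per-chart clauses + cover by the owned parts + disjointness ⇒ `MemberAtlasZF p M' c (Pc.image rd)`.

* **`memberAtlasZF_of_charts`**. AI-produced formalisation, weaker than expert review.
bears_on: LADDER-RESOLUTION:D157-DOOR2 (res-dim4-pi · S3 (c) v4 bridge).
-/

set_option linter.dupNamespace false -- D-0017: single-problem summit path `Summit.<S>.<S>.…` by design

noncomputable section

open MvPolynomial Finset CategoryTheory AlgebraicGeometry Opposite TopologicalSpace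
open AlgebraicGeometry.Scheme.IdealSheafData (ofIdealTop vanishingIdeal)

namespace Summit.ResolutionOfSingularities.ResolutionOfSingularities.Theorems.PIDim4

open Literature.AlgebraicGeometry.Resolution
open Literature.AlgebraicGeometry.Resolution.Hauser2010
open Literature.AlgebraicGeometry.Resolution.AffinePointBlowup (P A γ coord Wtop ξ)

namespace Equimultiple

section Bridge

variable {K : Type} [Field K] (p : ℕ) [DecidableEq K] {X' : Scheme.{0}}

/-- **A CHART-INDEXED ATLAS IS A `MemberAtlasZF`.** Charts `i ∈ Pc`, an injective reading map `rd`, zigzags `X′ ←φ_i— Y_i —ψ_i→ 𝔸⁵`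
satisfying the per-reading clauses of `MemberAtlasZF` at `rd i`, the cover of `c` by the images of the owned subspaces and their pairwise
disjointness ⇒ `MemberAtlasZF p M' c (Pc.image rd)`. [cite: BierstoneGrigorievMilmanWlodarczyk2011, Def. 3.1.3 (2), (4)] [cite: Hauser2010, §G] -/
theorem memberAtlasZF_of_charts [DecidableEq (AReading K)] (M' : MarkedIdeal X') (c : Closeds X') (Pc : Finset (Fin 4))
    (rd : Fin 4 → AReading K) (hinj : ∀ m ∈ Pc, ∀ m' ∈ Pc, rd m = rd m' → m = m')
    (Yc : ↥Pc → Scheme.{0}) (φc : ∀ i : ↥Pc, Yc i ⟶ X') (ψc : ∀ i : ↥Pc, Yc i ⟶ P 4 K)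
    (hcl : ∀ i : ↥Pc, IsOpenImmersion (φc i) ∧ IsOpenImmersion (ψc i) ∧
      M'.ideal.comap (φc i) = (hypSheaf p (rd i.1).1.F).comap (ψc i) ∧
      (vanishingIdeal c).comap (φc i) =
        (AffineCoordBlowup.𝓘Λ 4 K (insert 0 (Fin.succ '' ((rd i.1).2.1 : Set (Fin 4))))).comap (ψc i) ∧
      (AffineCoordBlowup.CΛ 4 K (insert 0 (Fin.succ '' ((rd i.1).2.1 : Set (Fin 4)))) : Set (P 4 K)) ⊆ Set.range (ψc i) ∧
      (∀ v : Fin 4 → K, IsClosed (φc i '' (ψc i ⁻¹' ownedSetZ (rd i.1).2.1 ((rd i.1).2.2.2.image fun m => (m, v m))))) ∧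
      ∃ (idx : X'.IdealSheafData → Fin 4) (cst_ : X'.IdealSheafData → K),
        (∀ D ∈ M'.boundary,
          ((D.support : Set X') ∩ φc i '' (ψc i ⁻¹'
            (AffineCoordBlowup.CΛ 4 K (insert 0 (Fin.succ '' ((rd i.1).2.1 : Set (Fin 4)))) : Set (P 4 K)))).Nonempty →
          D.comap (φc i) = (ofIdealTop (Ideal.span {(γ 4 K).symm (X (idx D).succ + C (cst_ D))})).comap (ψc i) ∧
            (idx D ∈ (rd i.1).2.1 → cst_ D = 0)) ∧
        (∀ D₁ ∈ M'.boundary, ∀ D₂ ∈ M'.boundary,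
          ((D₁.support : Set X') ∩ φc i '' (ψc i ⁻¹'
            (AffineCoordBlowup.CΛ 4 K (insert 0 (Fin.succ '' ((rd i.1).2.1 : Set (Fin 4)))) : Set (P 4 K)))).Nonempty →
          ((D₂.support : Set X') ∩ φc i '' (ψc i ⁻¹'
            (AffineCoordBlowup.CΛ 4 K (insert 0 (Fin.succ '' ((rd i.1).2.1 : Set (Fin 4)))) : Set (P 4 K)))).Nonempty →
          idx D₁ = idx D₂ → D₁ = D₂))
    (hcov : (c : Set X') ⊆ ⋃ i : ↥Pc, φc i '' (ψc i ⁻¹' ownedSetZ (rd i.1).2.1 (rd i.1).2.2.1))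
    (hdisj : ∀ i i' : ↥Pc, i ≠ i' →
      Disjoint (φc i '' (ψc i ⁻¹' ownedSetZ (rd i.1).2.1 (rd i.1).2.2.1)) (φc i' '' (ψc i' ⁻¹' ownedSetZ (rd i'.1).2.1 (rd i'.1).2.2.1))) :
    MemberAtlasZF p M' c (Pc.image rd) := by
  classical
  -- the chart of a reading
  have hex : ∀ r : ↥(Pc.image rd), ∃ m ∈ Pc, rd m = (r : AReading K) := fun r => Finset.mem_image.mp r.2
  let ι : ↥(Pc.image rd) → ↥Pc := fun r => ⟨(hex r).choose, (hex r).choose_spec.1⟩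
  have hι : ∀ r : ↥(Pc.image rd), rd (ι r).1 = (r : AReading K) := fun r => (hex r).choose_spec.2
  have hιinj : ∀ r r' : ↥(Pc.image rd), ι r = ι r' → r = r' := by
    intro r r' h
    apply Subtype.ext
    rw [← hι r, ← hι r', h]
  have hιrd : ∀ i : ↥Pc, ι ⟨rd i.1, Finset.mem_image_of_mem rd i.2⟩ = i := by
    intro i
    apply Subtype.ext
    exact hinj _ (ι ⟨rd i.1, Finset.mem_image_of_mem rd i.2⟩).2 _ i.2 (hι ⟨rd i.1, Finset.mem_image_of_mem rd i.2⟩)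
  refine ⟨fun r => Yc (ι r), fun r => φc (ι r), fun r => ψc (ι r), fun r => ?_, ?_, fun r r' hne => ?_⟩
  · -- the per-reading clauses, read at the chart `ι r`
    have h := hcl (ι r)
    rw [hι r] at h
    exact h
  · -- the cover
    intro x hx
    obtain ⟨i, hxi⟩ := Set.mem_iUnion.mp (hcov hx)
    refine Set.mem_iUnion.mpr ⟨⟨rd i.1, Finset.mem_image_of_mem rd i.2⟩, ?_⟩
    have key : ∀ i' : ↥Pc, i' = i → x ∈ φc i' '' (ψc i' ⁻¹' ownedSetZ (rd i.1).2.1 (rd i.1).2.2.1) := by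
      rintro _ rfl; exact hxi
    exact key _ (hιrd i)
  · -- disjointness
    have hne' : ι r ≠ ι r' := fun h => hne (hιinj r r' h)
    have h := hdisj (ι r) (ι r') hne'
    rw [hι r, hι r'] at h
    exact h

end Bridge

end Equimultiple

end Summit.ResolutionOfSingularities.ResolutionOfSingularities.Theorems.PIDim4

end
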